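import Summits.CriticalPhenomena.PercolationContinuityZ3.Theorems.Transplant.SnowballSqueezeScales
import HarnessLib

/-!
# The snowball squeeze, STEP 2 part (b2): THE TOWER'S ARITHMETIC — the floor and budget inequalities of the prescribed schedule, the sprinkling
# ladder, and the scales (generic; kernel; pure real analysis plus «Scales»; no named fact inside)

Proof file (`--supports stmt-CriticalPhenomena-4575`), lane `prim-bschramm`, seat `prim-bschramm-gen-1` gen 11 (GEN pen), lead g28's conditional GO #9067 / #9090 for N1
STEP 2.  builds on p205010 (kernel theorem, internal audit signed; external expert review pending) — nothing in this file uses p205010.  Def-free; no instance, no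
notation, no sorry, no `@[conjecture]`, default heartbeats; nothing about `θ(p_c)`, no witness, no named fact.

CONTENT (namespace `…Transplant.SnowballSqueeze`), the arithmetic of the tower in «SnowballSqueezeTower» (memo SUPPLEMENT-N1 §3 S2–S3 in the prescribed-schedule
form: sprinkles `δ_k = δ₀ 2^{−k}`, floors `F_k = 4e^{−G_k}` with `G_k = 2^k G₀ + (2^k − 1)K₂`, scales with `log|B(o,m_{k+1})| ≥ 64 log|B(o,m_k)|`):
* `one_add_le_eight_pow`, `one_add_le_sixtyfour_pow` (Bernoulli), `linear_sub_log_mono` (`x ↦ θx − a⁻¹ log x` increases beyond `1/(aθ)`);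
* `tower_G_le` (`G_k ≤ 2^{k+1} G₀`), **`tower_floor`** (the floor requirement `G_k ≤ c₁ δ_k⁴ log|B(o,m_k)|` from `c₁δ₀⁴ = G₀/b₀`, `K₂ ≤ G₀`,
  `log|B(o,m_k)| ≥ 64^k b₀`), **`tower_budget`** (the budget requirement `(3N_G + 13)(64 log|B(o,m_k)|/c_G)^{1/a} ≤ c₃ exp(c₁ δ_k³ log|B(o,m_k)|)` from
  `Q₀ = c₁δ₀³b₀` large), **`sprinkle_ladder`** (parameters `q_k = Spr(q; 2δ₀(1 − 2^{−k}))` with `δ(q_k, q_{k+1}) = δ₀2^{−k}`, all below `Spr(q; 2δ₀)`),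
  **`tower_scales`** (scales `m_k` with `log|B(o,m_k)| ≥ 64^k log|B(o,m)|` and `3m_{k+1} + 1 ≤ (3N_G + 13)(64 log|B(o,m_k)|/c_G)^{1/a}`, from «Scales»
  `exists_scale`).
[cite: EasoHutchcroft2023, §3.1 (Spr, δ) and §4.2 (snowballing across scales)] [cite: Hutchcroft2016, §1 (|B(x,n)|)]
-/

noncomputable section

namespace Summit.CriticalPhenomena.PercolationContinuityZ3.Theorems.Transplant

namespace SnowballSqueeze

open SimpleGraph MeasureTheory Filter Literature.Barriers.CriticalPhenomena Literature.Probability.Percolation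
  Literature.Probability.Percolation.Snowballing
open scoped Classical Topology

variable {V : Type}

/-- `8^k ≥ 1 + 7k ≥ 1 + k` (Bernoulli). [folklore] -/
theorem one_add_le_eight_pow (k : ℕ) : 1 + (k : ℝ) ≤ (8 : ℝ) ^ k := by
  have h := one_add_le_pow_of_two_add_nonneg (show (0 : ℝ) ≤ 2 + 7 by norm_num) k
  have hk : (0 : ℝ) ≤ k := Nat.cast_nonneg k
  calc 1 + (k : ℝ) ≤ 1 + (k : ℝ) * 7 := by linarith
    _ ≤ (1 + 7) ^ k := h
    _ = 8 ^ k := by norm_num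

/-- `64^k ≥ 1 + k`. [folklore] -/
theorem one_add_le_sixtyfour_pow (k : ℕ) : 1 + (k : ℝ) ≤ (64 : ℝ) ^ k := by
  have h := one_add_le_pow_of_two_add_nonneg (show (0 : ℝ) ≤ 2 + 63 by norm_num) k
  have hk : (0 : ℝ) ≤ k := Nat.cast_nonneg k
  calc 1 + (k : ℝ) ≤ 1 + (k : ℝ) * 63 := by linarith
    _ ≤ (1 + 63) ^ k := h
    _ = 64 ^ k := by norm_num

/-- Monotonicity of `x ↦ θx − a⁻¹ log x` beyond `x₀ ≥ 1/(aθ)`: `θ x₀ − a⁻¹ log x₀ ≤ θ x − a⁻¹ log x` for `x ≥ x₀ > 0` (from `log t ≤ t − 1`). [folklore] -/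
theorem linear_sub_log_mono {a θ x₀ x : ℝ} (ha : 0 < a) (hx₀ : 0 < x₀) (hθ : 1 ≤ a * θ * x₀) (hx : x₀ ≤ x) :
    θ * x₀ - (1 / a) * Real.log x₀ ≤ θ * x - (1 / a) * Real.log x := by
  have hxpos : 0 < x := hx₀.trans_le hx
  have hlog : Real.log x - Real.log x₀ ≤ x / x₀ - 1 := by
    rw [← Real.log_div hxpos.ne' hx₀.ne']
    exact Real.log_le_sub_one_of_pos (div_pos hxpos hx₀)
  have hθ' : 1 / a * (x / x₀ - 1) ≤ θ * (x - x₀) := by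
    have e : x / x₀ - 1 = (x - x₀) / x₀ := by field_simp
    rw [e, one_div, ← div_eq_inv_mul, div_div, div_le_iff₀ (by positivity)]
    have hxx : 0 ≤ x - x₀ := by linarith
    calc x - x₀ = (x - x₀) * 1 := by ring
      _ ≤ (x - x₀) * (a * θ * x₀) := mul_le_mul_of_nonneg_left hθ hxx
      _ = θ * (x - x₀) * (x₀ * a) := by ring
  have : 1 / a * (Real.log x - Real.log x₀) ≤ θ * (x - x₀) :=
    (mul_le_mul_of_nonneg_left hlog (by positivity)).trans hθ'
  have e1 : 1 / a * (Real.log x - Real.log x₀) = 1 / a * Real.log x - 1 / a * Real.log x₀ := by ring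
  have e2 : θ * (x - x₀) = θ * x - θ * x₀ := by ring
  linarith only [this, e1, e2]

/-! ## The tower's arithmetic, isolated (pure real analysis) -/

/-- `G_k = 2^k G₀ + (2^k − 1) K₂ ≤ 2^{k+1} G₀` when `0 ≤ K₂ ≤ G₀`. [folklore] -/
theorem tower_G_le {G₀ K₂ : ℝ} (hK₂ : 0 ≤ K₂) (hK₂G : K₂ ≤ G₀) (k : ℕ) :
    (2 : ℝ) ^ k * G₀ + ((2 : ℝ) ^ k - 1) * K₂ ≤ (2 : ℝ) ^ (k + 1) * G₀ := by
  have h2k : (1 : ℝ) ≤ 2 ^ k := one_le_pow₀ (by norm_num)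
  have h1 : ((2 : ℝ) ^ k - 1) * K₂ ≤ 2 ^ k * K₂ := mul_le_mul_of_nonneg_right (by linarith only [h2k]) hK₂
  have h2 : (2 : ℝ) ^ k * K₂ ≤ 2 ^ k * G₀ := mul_le_mul_of_nonneg_left hK₂G (by positivity)
  rw [pow_succ]; linarith only [h1, h2]

/-- **The floor requirement of step `k`**: with `c₁ δ₀⁴ = G₀/b₀`, `0 ≤ K₂ ≤ G₀` and `log|B(o,m_k)| ≥ 64^k b₀`, the prescribed sprinkle `δ_k = δ₀ 2^{−k}`
satisfies `G_k ≤ c₁ δ_k⁴ · log|B(o,m_k)|`. [folklore] -/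
theorem tower_floor {c₁ δ₀ G₀ b₀ K₂ bk : ℝ} (hG₀ : 0 < G₀) (hb₀ : 0 < b₀) (hK₂ : 0 ≤ K₂) (hK₂G : K₂ ≤ G₀)
    (hc₁δ₀4 : c₁ * δ₀ ^ (4 : ℕ) = G₀ / b₀) (k : ℕ) (hbk : (64 : ℝ) ^ k * b₀ ≤ bk) :
    (2 : ℝ) ^ k * G₀ + ((2 : ℝ) ^ k - 1) * K₂ ≤ c₁ * (δ₀ / (2 : ℝ) ^ k) ^ (4 : ℕ) * bk := by
  have e : c₁ * (δ₀ / (2 : ℝ) ^ k) ^ (4 : ℕ) * bk = (G₀ / b₀) * bk / (16 : ℝ) ^ k := by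
    rw [← hc₁δ₀4, div_pow, show ((2 : ℝ) ^ k) ^ 4 = 16 ^ k by rw [← pow_mul, mul_comm, pow_mul]; norm_num]
    ring
  rw [e]
  have h4k : (4 : ℝ) ^ k * G₀ ≤ G₀ / b₀ * bk / 16 ^ k := by
    rw [le_div_iff₀ (by positivity), show (4 : ℝ) ^ k * G₀ * 16 ^ k = (G₀ / b₀) * (64 ^ k * b₀) by
      rw [show (64 : ℝ) ^ k = 4 ^ k * 16 ^ k by rw [← mul_pow]; norm_num]; field_simp]
    exact mul_le_mul_of_nonneg_left hbk (by positivity)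
  refine le_trans ?_ h4k
  rcases Nat.eq_zero_or_pos k with rfl | hk
  · simp
  · calc (2 : ℝ) ^ k * G₀ + ((2 : ℝ) ^ k - 1) * K₂ ≤ 2 ^ (k + 1) * G₀ := tower_G_le hK₂ hK₂G k
      _ = 2 * 2 ^ k * G₀ := by ring
      _ ≤ 2 ^ k * 2 ^ k * G₀ := by
          have h2 : (2 : ℝ) ≤ 2 ^ k := by
            calc (2 : ℝ) = 2 ^ 1 := by norm_num
              _ ≤ 2 ^ k := pow_le_pow_right₀ (by norm_num) hk
          exact mul_le_mul_of_nonneg_right (mul_le_mul_of_nonneg_right h2 (by positivity)) hG₀.le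
      _ = 4 ^ k * G₀ := by rw [← mul_pow]; norm_num

/-- **The budget requirement of step `k`**: with `Q₀ = c₁ δ₀³ b₀` large (`aQ₀ ≥ 1`, `Q₀ ≥ log 64/a`,
`Q₀ ≥ log(3N_G + 13) + a⁻¹ log(64/c_G) − log c₃ + a⁻¹ log b₀`) and `log|B(o,m_k)| ≥ 64^k b₀`, the station budget bought by the sprinkle `δ₀ 2^{−k}` exceeds
the next scale: `(3N_G + 13)·(64 log|B(o,m_k)|/c_G)^{1/a} ≤ c₃ exp(c₁ (δ₀ 2^{−k})³ log|B(o,m_k)|)`. [folklore] -/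
theorem tower_budget {a cG c₃ c₁ δ₀ b₀ Q₀ bk : ℝ} {NG : ℕ} (ha : 0 < a) (hcG : 0 < cG) (hc₃ : 0 < c₃) (hc₁ : 0 < c₁) (hδ₀ : 0 < δ₀)
    (hb₀ : 0 < b₀) (hQ₀def : Q₀ = c₁ * δ₀ ^ (3 : ℕ) * b₀) (hQ₀pos : 0 < Q₀) (hQ₀a : 1 ≤ a * Q₀) (hQ₀64 : Real.log 64 / a ≤ Q₀)
    (hQ₀K₉ : Real.log (3 * NG + 13) + (1 / a) * Real.log (64 / cG) - Real.log c₃ + (1 / a) * Real.log b₀ ≤ Q₀)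
    (k : ℕ) (hbk : (64 : ℝ) ^ k * b₀ ≤ bk) :
    (3 * (NG : ℝ) + 13) * (64 * bk / cG) ^ (1 / a) ≤ c₃ * Real.exp (c₁ * (δ₀ / (2 : ℝ) ^ k) ^ (3 : ℕ) * bk) := by
  have hbkpos : 0 < bk := lt_of_lt_of_le (by positivity) hbk
  obtain ⟨θ, hθ⟩ : ∃ θ : ℝ, θ = c₁ * δ₀ ^ (3 : ℕ) / (8 : ℝ) ^ k := ⟨_, rfl⟩
  have hθpos : 0 < θ := by rw [hθ]; positivity
  have eQ : c₁ * (δ₀ / (2 : ℝ) ^ k) ^ (3 : ℕ) * bk = θ * bk := by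
    rw [hθ, div_pow, show ((2 : ℝ) ^ k) ^ 3 = 8 ^ k by rw [← pow_mul, mul_comm, pow_mul]; norm_num]; ring
  rw [eQ]
  obtain ⟨X₀, hX₀⟩ : ∃ X₀ : ℝ, X₀ = (64 : ℝ) ^ k * b₀ := ⟨_, rfl⟩
  have hX₀pos : 0 < X₀ := by rw [hX₀]; positivity
  have eθX₀ : θ * X₀ = (8 : ℝ) ^ k * Q₀ := by
    rw [hθ, hX₀, hQ₀def, show (64 : ℝ) ^ k = 8 ^ k * 8 ^ k by rw [← mul_pow]; norm_num]
    field_simp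
  have hX₀le : X₀ ≤ bk := by rw [hX₀]; exact hbk
  -- the inequality at `X₀`
  have hlogX₀ : Real.log (64 * X₀ / cG) = Real.log (64 / cG) + k * Real.log 64 + Real.log b₀ := by
    rw [hX₀, show (64 : ℝ) * (64 ^ k * b₀) / cG = (64 / cG) * (64 ^ k * b₀) by ring,
      Real.log_mul (by positivity) (by positivity), Real.log_mul (by positivity) hb₀.ne', Real.log_pow]
    ring
  have hatX₀ : Real.log (3 * NG + 13) + (1 / a) * Real.log (64 * X₀ / cG) ≤ Real.log c₃ + θ * X₀ := by
    rw [hlogX₀, eθX₀]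
    have h8 : (1 + k : ℝ) * Q₀ ≤ 8 ^ k * Q₀ := mul_le_mul_of_nonneg_right (one_add_le_eight_pow k) hQ₀pos.le
    have hk0 : (0 : ℝ) ≤ k := Nat.cast_nonneg k
    have hkQ : (k : ℝ) * (Real.log 64 / a) ≤ k * Q₀ := mul_le_mul_of_nonneg_left hQ₀64 hk0
    have e1 : (1 / a) * (Real.log (64 / cG) + k * Real.log 64 + Real.log b₀) =
        (1 / a) * Real.log (64 / cG) + k * (Real.log 64 / a) + (1 / a) * Real.log b₀ := by ring
    rw [e1]
    have e8 : (1 + k : ℝ) * Q₀ = Q₀ + k * Q₀ := by ring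
    linarith only [hQ₀K₉, hkQ, h8, e8]
  -- monotonicity from `X₀` to `bk` (for `x ↦ θ' x − a⁻¹ log x`, `θ' = θ cG/64`, `x = 64(·)/cG`)
  have eθ' : θ * cG / 64 * (64 * X₀ / cG) = θ * X₀ := by field_simp
  have eθ'' : θ * cG / 64 * (64 * bk / cG) = θ * bk := by field_simp
  have hmono := linear_sub_log_mono (a := a) (θ := θ * cG / 64) (x₀ := 64 * X₀ / cG) (x := 64 * bk / cG) ha (by positivity)
    (by
      rw [mul_assoc, eθ', eθX₀]
      have h8 : (1 : ℝ) ≤ 8 ^ k := one_le_pow₀ (by norm_num)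
      have h9 : a * Q₀ ≤ a * (8 ^ k * Q₀) := mul_le_mul_of_nonneg_left (le_mul_of_one_le_left hQ₀pos.le h8) ha.le
      linarith only [h9, hQ₀a])
    (by rw [div_le_div_iff_of_pos_right hcG]; linarith only [hX₀le])
  rw [eθ', eθ''] at hmono
  have hgoal : Real.log (3 * NG + 13) + (1 / a) * Real.log (64 * bk / cG) ≤ Real.log c₃ + θ * bk := by
    linarith only [hatX₀, hmono]
  have e : (3 * NG + 13 : ℝ) * (64 * bk / cG) ^ (1 / a) = Real.exp (Real.log (3 * NG + 13) + (1 / a) * Real.log (64 * bk / cG)) := by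
    rw [Real.exp_add, Real.exp_log (by positivity), Real.rpow_def_of_pos (by positivity), mul_comm (Real.log _)]
  have e' : c₃ * Real.exp (θ * bk) = Real.exp (Real.log c₃ + θ * bk) := by rw [Real.exp_add, Real.exp_log hc₃]
  rw [e, e']
  exact Real.exp_le_exp.2 hgoal

/-- **The sprinkling ladder**: parameters `q_k = Spr(q; 2δ₀(1 − 2^{−k}))` increase from `q₀ = q`, stay below `p_∞ = Spr(q; 2δ₀) < 1`, and consecutive
sprinkling distances are exactly `δ(q_k, q_{k+1}) = δ₀ 2^{−k}`. [cite: EasoHutchcroft2023, §3.1 p. 19 (semigroup property of Spr)] -/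
theorem sprinkle_ladder {q δ₀ : ℝ} (hq0 : 0 < q) (hq1 : q < 1) (hδ₀ : 0 < δ₀) :
    ∃ (qI : ℕ → unitInterval) (pinfI : unitInterval),
      ((qI 0 : unitInterval) : ℝ) = q ∧ ((pinfI : unitInterval) : ℝ) = spr q (2 * δ₀) ∧
      (∀ k, ((qI k : unitInterval) : ℝ) < (qI (k + 1) : unitInterval)) ∧ (∀ k, ((qI k : unitInterval) : ℝ) < 1) ∧
      (∀ k, q ≤ (qI k : unitInterval)) ∧ (∀ k, sprDist (qI k : ℝ) (qI (k + 1) : ℝ) = δ₀ / (2 : ℝ) ^ k) ∧ (∀ k, qI k ≤ pinfI) := by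
  obtain ⟨S, hS⟩ : ∃ S : ℕ → ℝ, ∀ k, S k = 2 * δ₀ * (1 - (1 / 2 : ℝ) ^ k) := ⟨_, fun _ => rfl⟩
  have hS0 : S 0 = 0 := by rw [hS]; simp
  have hS_nonneg : ∀ k, 0 ≤ S k := fun k => by
    have h : (1 / 2 : ℝ) ^ k ≤ 1 := pow_le_one₀ (by norm_num) (by norm_num)
    rw [hS]; exact mul_nonneg (by positivity) (by linarith only [h])
  have hS_le : ∀ k, S k ≤ 2 * δ₀ := fun k => by
    have e : 2 * δ₀ * (1 - (1 / 2 : ℝ) ^ k) = 2 * δ₀ - 2 * δ₀ * (1 / 2 : ℝ) ^ k := by ring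
    have h2 : 0 ≤ 2 * δ₀ * (1 / 2 : ℝ) ^ k := by positivity
    rw [hS]; linarith only [e, h2]
  have hS_succ : ∀ k, S (k + 1) - S k = δ₀ / (2 : ℝ) ^ k := by
    intro k
    rw [hS, hS, pow_succ, one_div_pow]; field_simp; ring
  have hS_lt : ∀ k, S k < S (k + 1) := fun k => by
    have : 0 < δ₀ / (2 : ℝ) ^ k := by positivity
    linarith only [hS_succ k, this]
  obtain ⟨qk, hqk⟩ : ∃ qk : ℕ → ℝ, ∀ k, qk k = spr q (S k) := ⟨_, fun _ => rfl⟩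
  have hqk0 : qk 0 = q := by rw [hqk, hS0]; simp [spr]
  have hqk_ge : ∀ k, q ≤ qk k := fun k => by rw [hqk]; exact le_spr hq0.le hq1 (hS_nonneg k)
  have hqk_lt1 : ∀ k, qk k < 1 := fun k => by rw [hqk]; exact spr_lt_one _ hq1
  have hqk_pos : ∀ k, 0 < qk k := fun k => hq0.trans_le (hqk_ge k)
  have hqk_lt : ∀ k, qk k < qk (k + 1) := fun k => by
    have h := spr_lt_spr hq0 hq1 (hS_lt k)
    rwa [← hqk, ← hqk] at h
  have hqk_dist : ∀ k, sprDist (qk k) (qk (k + 1)) = δ₀ / (2 : ℝ) ^ k := by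
    intro k
    have h1 : sprDist q (qk k) = S k := by rw [hqk]; exact sprDist_spr (S k) hq0 hq1
    have h2 : sprDist q (qk (k + 1)) = S (k + 1) := by rw [hqk]; exact sprDist_spr (S (k + 1)) hq0 hq1
    have h3 := sprDist_add hq0 hq1 (hqk_pos k) (hqk_lt1 k) (hqk_pos (k + 1)) (hqk_lt1 (k + 1))
    rw [h1, h2] at h3
    linarith only [h3, hS_succ k]
  have hpinflt1 : spr q (2 * δ₀) < 1 := spr_lt_one _ hq1
  have hpinfpos : 0 < spr q (2 * δ₀) := hq0.trans_le (le_spr hq0.le hq1 (by positivity))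
  refine ⟨fun k => ⟨qk k, (hqk_pos k).le, (hqk_lt1 k).le⟩, ⟨spr q (2 * δ₀), hpinfpos.le, hpinflt1.le⟩, hqk0, rfl, hqk_lt, hqk_lt1,
    hqk_ge, hqk_dist, fun k => ?_⟩
  exact Subtype.coe_le_coe.1 (by rw [Subtype.coe_mk, Subtype.coe_mk, hqk]; exact spr_le_spr hq0.le hq1 (hS_le k))

/-- **The scales**: from `exp(c_G n^a) ≤ |B(o,n)|` (`n ≥ N_G`) and `m ≥ max(1, N_G)`, scales `m = m_0 < m_1 < …` with
`log|B(o,m_{k})| ≥ 64^k log|B(o,m)|` and `3 m_{k+1} + 1 ≤ (3N_G + 13)(64 log|B(o,m_k)|/c_G)^{1/a}`. [folklore] -/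
theorem tower_scales (G : SimpleGraph V) [G.LocallyFinite] (o : V) {cG a : ℝ} (hcG : 0 < cG) (ha : 0 < a) {NG : ℕ}
    (hNG : ∀ n : ℕ, NG ≤ n → Real.exp (cG * (n : ℝ) ^ a) ≤ (ballVolume G o n : ℝ)) {m : ℕ} (hm1 : 1 ≤ m) (hmNG : NG ≤ m) :
    ∃ ms : ℕ → ℕ, ms 0 = m ∧ (∀ k, m ≤ ms k) ∧
      (∀ k, (64 : ℝ) ^ k * Real.log (ballVolume G o m : ℝ) ≤ Real.log (ballVolume G o (ms k) : ℝ)) ∧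
      (∀ k, 3 * (ms (k + 1) : ℝ) + 1 ≤ (3 * NG + 13) * (64 * Real.log (ballVolume G o (ms k) : ℝ) / cG) ^ (1 / a)) := by
  have hB1 : ∀ n, (1 : ℝ) ≤ (ballVolume G o n : ℝ) := fun n => by exact_mod_cast one_le_ballVolume G o n
  have hBpos : ∀ n, (0 : ℝ) < (ballVolume G o n : ℝ) := fun n => by linarith only [hB1 n]
  have hbgr : ∀ n, NG ≤ n → cG * (n : ℝ) ^ a ≤ Real.log (ballVolume G o n : ℝ) :=
    fun n hn => (Real.le_log_iff_exp_le (hBpos n)).2 (hNG n hn)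
  have hex : ∀ n : ℕ, ∃ n' : ℕ, n < n' ∧ NG ≤ n' ∧ Real.exp (64 * Real.log (ballVolume G o n : ℝ)) ≤ (ballVolume G o n' : ℝ) ∧
      (n' : ℝ) ≤ n + NG + (64 * Real.log (ballVolume G o n : ℝ) / cG) ^ (1 / a) + 2 :=
    fun n => exists_scale G o hcG ha hNG n (L := 64 * Real.log (ballVolume G o n : ℝ)) (by have := hB1 n; positivity)
  choose next hnext using hex
  obtain ⟨ms, hms0, hms_succ⟩ : ∃ ms : ℕ → ℕ, ms 0 = m ∧ ∀ k, ms (k + 1) = next (ms k) :=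
    ⟨fun k => next^[k] m, rfl, fun k => Function.iterate_succ_apply' next k m⟩
  obtain ⟨bk, hbk⟩ : ∃ bk : ℕ → ℝ, ∀ k, bk k = Real.log (ballVolume G o (ms k) : ℝ) := ⟨_, fun _ => rfl⟩
  have hms_ge : ∀ k, m ≤ ms k ∧ NG ≤ ms k := by
    intro k
    induction k with
    | zero => rw [hms0]; exact ⟨le_rfl, hmNG⟩
    | succ k ih => rw [hms_succ]; exact ⟨ih.1.trans (hnext _).1.le, (hnext _).2.1⟩
  have hms_pos : ∀ k, (0 : ℝ) < (ms k : ℝ) := fun k => by exact_mod_cast lt_of_lt_of_le hm1 (hms_ge k).1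
  have hbk_gr : ∀ k, cG * (ms k : ℝ) ^ a ≤ bk k := fun k => by rw [hbk]; exact hbgr (ms k) (hms_ge k).2
  have hbk_succ : ∀ k, 64 * bk k ≤ bk (k + 1) := by
    intro k
    have h := (hnext (ms k)).2.2.1
    rw [← hms_succ, ← hbk] at h
    rw [hbk (k + 1)]
    exact (Real.le_log_iff_exp_le (hBpos _)).2 h
  have hbk_ge : ∀ k, (64 : ℝ) ^ k * bk 0 ≤ bk k := by
    intro k
    induction k with
    | zero => simp
    | succ k ih => calc (64 : ℝ) ^ (k + 1) * bk 0 = 64 * (64 ^ k * bk 0) := by ring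
        _ ≤ 64 * bk k := by linarith only [ih]
        _ ≤ bk (k + 1) := hbk_succ k
  have hb0pos : 0 < bk 0 := by
    have h := hbk_gr 0
    have : 0 < cG * (ms 0 : ℝ) ^ a := mul_pos hcG (Real.rpow_pos_of_pos (hms_pos 0) a)
    linarith only [h, this]
  have hbk_pos : ∀ k, 0 < bk k := fun k => lt_of_lt_of_le (by positivity) (hbk_ge k)
  have hbk_ge0 : ∀ k, bk 0 ≤ bk k := fun k => le_trans (by
    have h1 : (1 : ℝ) ≤ 64 ^ k := one_le_pow₀ (by norm_num)
    have h2 := mul_le_mul_of_nonneg_right h1 hb0pos.le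
    linarith only [h2]) (hbk_ge k)
  have hms_le : ∀ k, (ms k : ℝ) ≤ (bk k / cG) ^ (1 / a) := by
    intro k
    have h1 : (ms k : ℝ) ^ a ≤ bk k / cG := by rw [le_div_iff₀' hcG]; exact hbk_gr k
    have h2 := Real.rpow_le_rpow (by positivity) h1 (by positivity : (0 : ℝ) ≤ 1 / a)
    rw [one_div] at h2 ⊢
    rwa [Real.rpow_rpow_inv (hms_pos k).le ha.ne'] at h2
  have hcG_le : cG ≤ bk 0 := by
    have h0 := hbk_gr 0
    have h1 : (1 : ℝ) ≤ (ms 0 : ℝ) ^ a := Real.one_le_rpow (by exact_mod_cast le_trans hm1 (hms_ge 0).1) ha.le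
    have h2 : cG * 1 ≤ cG * (ms 0 : ℝ) ^ a := mul_le_mul_of_nonneg_left h1 hcG.le
    linarith only [h0, h2]
  have hW1 : ∀ k, (1 : ℝ) ≤ (64 * bk k / cG) ^ (1 / a) := by
    intro k
    have h1 : (1 : ℝ) ≤ 64 * bk k / cG := by
      rw [le_div_iff₀ hcG]
      linarith only [hcG_le, hbk_ge0 k, hbk_pos k]
    exact Real.one_le_rpow h1 (by positivity)
  refine ⟨ms, hms0, fun k => (hms_ge k).1, fun k => ?_, fun k => ?_⟩
  · have h := hbk_ge k
    rw [hbk, hbk, hms0] at h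
    exact h
  · have h1 := (hnext (ms k)).2.2.2
    rw [← hms_succ, ← hbk] at h1
    have h2 : (bk k / cG) ^ (1 / a) ≤ (64 * bk k / cG) ^ (1 / a) :=
      Real.rpow_le_rpow (div_nonneg (hbk_pos k).le hcG.le) (by rw [div_le_div_iff_of_pos_right hcG]; linarith only [hbk_pos k]) (by positivity)
    have h3 := hms_le k
    have hNG0 : (0 : ℝ) ≤ NG := Nat.cast_nonneg NG
    have hWk := hW1 k
    have h4 : (NG : ℝ) ≤ NG * (64 * bk k / cG) ^ (1 / a) := le_mul_of_one_le_right hNG0 hWk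
    have e : (3 * (NG : ℝ) + 13) * (64 * bk k / cG) ^ (1 / a) = 3 * (NG * (64 * bk k / cG) ^ (1 / a)) + 13 * (64 * bk k / cG) ^ (1 / a) := by ring
    rw [← hbk]
    linarith only [h1, h2, h3, h4, hWk, e]

end SnowballSqueeze

end Summit.CriticalPhenomena.PercolationContinuityZ3.Theorems.Transplant
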